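import Mathlib
import Summits.ResolutionOfSingularities.ResolutionOfSingularities.Theorems.HomologicalConductorSurfaceTerminationCubicTriangleExit
import Summits.ResolutionOfSingularities.ResolutionOfSingularities.Theorems.HomologicalConductorSurfaceTerminationCubicConeWitnessDim
import HarnessLib

/-!
# Kill test `SurfaceTermination` (stmt-ResolutionOfSingularities-16488), (R-QH) piece 2 «CUBIC TRIANGLE», part 4:
# NON-VACUITY for a GENERAL prime form `f` — `K = Frac (k[X] ⧸ (f))` carries the weight valuation; the exit is inhabited

Route `ResolutionOfSingularities/HomologicalConductor` (cell `res-hironaka`, chain W4.4), kill test `SurfaceTermination`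
(stmt-16488), residue stub `stub_initialPairOfConstantGenus` ((E)-form); res-L0-w44-plan-1 CHAIN v21 (ρ35e) / v23 standing
offer **(R-QH)**, piece 2, res-D-pv-045 g7. OURS; AI-written, weaker than expert review; nothing here is a statement of the
manuscript under review (Hironaka 2017) and no statement of it is used; no theorem here concludes the kill test or the crux.

This is `…CubicConeWitness` (p546768) / `…CubicConeWitnessDim` (p548267) with the cubic ABSTRACTED to any PRIME FORM `f` of
degree `d` in `k[X₀,X₁,X₂]` through the coordinate points (for the witness of `hW` only `f(1,0,0) = 0` is used):
* §1 for a field `K` and an injective `ι : k[X] ⧸ (f) → K`: `hker` (`ker_aeval_eq_span`), the graded embedding `Xᵢ ↦ C(xᵢ)·T`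
  kills `f` and is injective modulo `(f)` (`mem_span_of_aeval_C_mul_X_eq_zero`);
* §2 `K = Frac (k[X] ⧸ (f))`: **`exists_weightValuation`** (`O ∋ k`, `O.valuation x < 1`, the WEIGHT property — the `T`-adic
  valuation of `K(T)` pulled back along the graded embedding), `isFractionRing_range`, `ringKrullDim_range_eq_two` (`f` prime,
  tree hypersurface formula);
* §3 **`exists_witness_of_prime`** — for every field `k` and every prime form `f` through the coordinate triangle: `K, x, y, z, O`
  with `hker ∧ hk ∧ hx ∧ hW ∧ IsFractionRing ↥k[x,y,z] K ∧ ringKrullDim ↥k[x,y,z] = 2`; **`prime_cubicTriangle_std`** — the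
  member `a = (1,0,1,0,1,0,0)` (`x²y + y²z + z²x`, p546768's `prime_f`) is prime; and
  **`exists_isRegularLocalRing_tower_cubicTriangle_inhabited`** — for every prime `p`, field `k` of characteristic `p` and
  `a` with `a₀ ≠ 0`, `a₂ ≠ 0`, `f_a` prime: a kill-test datum `(A = k[x,y,z] cut out by f_a, O)` AT WHICH
  `∃ m, IsRegularLocalRing ↥(tower O A m)` holds by the kernel.
References (mechanism only): Mathlib (adic valuations of `K[T]`); [cite: Matsumura1987, Thm 5.6] via the tree.
-/

noncomputable section

-- single-problem summit: the doubled namespace component `ResolutionOfSingularities` is forced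
set_option linter.dupNamespace false

namespace Summit.ResolutionOfSingularities.ResolutionOfSingularities.Theorems.SurfaceTermination.CubicTriangle

open MvPolynomial
open Summit.ResolutionOfSingularities.ResolutionOfSingularities.Theorems.NoZeno.Birth

/-! ## §1 A field `K` with an injective `ι : k[X] ⧸ (f) → K` -/

section Model

variable {k K : Type} [Field k] [Field K] [Algebra k K] {f : MvPolynomial (Fin 3) k}
  (ι : (MvPolynomial (Fin 3) k ⧸ Ideal.span ({f} : Set (MvPolynomial (Fin 3) k))) →ₐ[k] K)

/-- `aeval (x,y,z) = ι ∘ mk` for `x, y, z` the images of `X₀, X₁, X₂` under `ι ∘ mk`. [folklore] -/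
theorem aeval_eq_comp_mk :
    MvPolynomial.aeval (R := k) (![ι (Ideal.Quotient.mk _ (X 0)), ι (Ideal.Quotient.mk _ (X 1)),
        ι (Ideal.Quotient.mk _ (X 2))] : Fin 3 → K) =
      ι.comp (Ideal.Quotient.mkₐ k (Ideal.span ({f} : Set (MvPolynomial (Fin 3) k)))) := by
  refine MvPolynomial.algHom_ext fun i => ?_
  rw [MvPolynomial.aeval_X, AlgHom.comp_apply, Ideal.Quotient.mkₐ_eq_mk]
  fin_cases i <;> rfl

variable (hι : Function.Injective ι)
include hι

/-- **`hker` in the model**: for an injective `ι`, the kernel of `Xᵢ ↦ ι(X̄ᵢ)` is exactly `(f)`. [folklore] -/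
theorem ker_aeval_eq_span :
    RingHom.ker (MvPolynomial.aeval (R := k) (![ι (Ideal.Quotient.mk _ (X 0)), ι (Ideal.Quotient.mk _ (X 1)),
        ι (Ideal.Quotient.mk _ (X 2))] : Fin 3 → K)).toRingHom = Ideal.span {f} := by
  ext p
  rw [RingHom.mem_ker, AlgHom.toRingHom_eq_coe, RingHom.coe_coe, aeval_eq_comp_mk, AlgHom.comp_apply,
    Ideal.Quotient.mkₐ_eq_mk, map_eq_zero_iff _ hι, Ideal.Quotient.eq_zero_iff_mem]

/-- The graded map `θ : k[X] → K[T]`, `Xᵢ ↦ C(xᵢ)·T`, kills the form `f` (of degree `d`, vanishing at `(x,y,z)`). [folklore] -/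
theorem aeval_C_mul_X_self {d : ℕ} (hfd : f.IsHomogeneous d) :
    MvPolynomial.aeval (fun i => Polynomial.C ((![ι (Ideal.Quotient.mk _ (X 0)), ι (Ideal.Quotient.mk _ (X 1)),
        ι (Ideal.Quotient.mk _ (X 2))] : Fin 3 → K) i) * Polynomial.X) f = 0 := by
  rw [CubicCone.aeval_C_mul_X_of_isHomogeneous _ hfd]
  have h0 : MvPolynomial.aeval (R := k) (![ι (Ideal.Quotient.mk _ (X 0)), ι (Ideal.Quotient.mk _ (X 1)),
      ι (Ideal.Quotient.mk _ (X 2))] : Fin 3 → K) f = 0 := by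
    have hmem : f ∈ RingHom.ker (MvPolynomial.aeval (R := k) (![ι (Ideal.Quotient.mk _ (X 0)),
        ι (Ideal.Quotient.mk _ (X 1)), ι (Ideal.Quotient.mk _ (X 2))] : Fin 3 → K)).toRingHom := by
      rw [ker_aeval_eq_span ι hι]; exact Ideal.mem_span_singleton_self _
    exact hmem
  rw [h0, map_zero, zero_mul]

/-- **The graded embedding is injective modulo `(f)`**: if `θ(F) = 0` then `F ∈ (f)` (read the coefficient of `Tᵉ` = the value
at `(x,y,z)` of the degree-`e` component of `F`, then `hker`). [folklore] -/
theorem mem_span_of_aeval_C_mul_X_eq_zero {F : MvPolynomial (Fin 3) k}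
    (hF : MvPolynomial.aeval (fun i => Polynomial.C ((![ι (Ideal.Quotient.mk _ (X 0)), ι (Ideal.Quotient.mk _ (X 1)),
        ι (Ideal.Quotient.mk _ (X 2))] : Fin 3 → K) i) * Polynomial.X) F = 0) :
    F ∈ Ideal.span ({f} : Set (MvPolynomial (Fin 3) k)) := by
  set g : Fin 3 → K := ![ι (Ideal.Quotient.mk _ (X 0)), ι (Ideal.Quotient.mk _ (X 1)), ι (Ideal.Quotient.mk _ (X 2))]
    with hg
  have hsum : MvPolynomial.aeval (fun i => Polynomial.C (g i) * Polynomial.X) F = ∑ e ∈ Finset.range (F.totalDegree + 1),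
      Polynomial.C (MvPolynomial.aeval g (homogeneousComponent e F)) * Polynomial.X ^ e := by
    conv_lhs => rw [← sum_homogeneousComponent F, map_sum]
    exact Finset.sum_congr rfl fun e _ =>
      CubicCone.aeval_C_mul_X_of_isHomogeneous g (homogeneousComponent_isHomogeneous e F)
  have hcomp : ∀ e, MvPolynomial.aeval g (homogeneousComponent e F) = 0 := by
    intro e
    by_cases he : e < F.totalDegree + 1
    · have hcoeff := congrArg (fun q : Polynomial K => q.coeff e) hF
      simp only [Polynomial.coeff_zero] at hcoeff
      rw [hsum, Polynomial.finsetSum_coeff, Finset.sum_eq_single e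
        (fun e' _ hed => by rw [Polynomial.coeff_C_mul_X_pow, if_neg (Ne.symm hed)])
        (fun h => absurd (Finset.mem_range.mpr he) h), Polynomial.coeff_C_mul_X_pow, if_pos rfl] at hcoeff
      exact hcoeff
    · rw [homogeneousComponent_eq_zero _ _ (by omega), map_zero]
  rw [← sum_homogeneousComponent F]
  refine Ideal.sum_mem _ fun e _ => ?_
  have hmem : homogeneousComponent e F ∈ RingHom.ker (MvPolynomial.aeval (R := k) g).toRingHom := hcomp e
  rwa [hg, ker_aeval_eq_span ι hι] at hmem

end Model

/-! ## §2 `K = Frac (k[X] ⧸ (f))`: the weight valuation, `Frac k[x,y,z] = K`, `dim k[x,y,z] = 2` -/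

section Valuation

variable {k K : Type} [Field k] [Field K] [Algebra k K] {f : MvPolynomial (Fin 3) k}
  [Algebra (MvPolynomial (Fin 3) k ⧸ Ideal.span ({f} : Set (MvPolynomial (Fin 3) k))) K]
  [IsScalarTower k (MvPolynomial (Fin 3) k ⧸ Ideal.span ({f} : Set (MvPolynomial (Fin 3) k))) K]
  [IsFractionRing (MvPolynomial (Fin 3) k ⧸ Ideal.span ({f} : Set (MvPolynomial (Fin 3) k))) K]

/-- **THE WEIGHT VALUATION EXISTS (OURS · W4.4 (R-QH) non-vacuity, general form).** `f` a form of degree `d` with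
`f(1,0,0) = 0`, `A = k[X] ⧸ (f)`, `K = Frac A`, `x, y, z` the images of `X₀, X₁, X₂`: there is a valuation ring `O ⊆ K` containing
`k` with `O.valuation x < 1` and the WEIGHT property `O.valuation (F(x,y,z)) = (O.valuation x)ᵉ` for every non-vanishing form `F`
of degree `e` (the `T`-adic valuation of `K(T)` pulled back along `A ↪ K[T]`, `Xᵢ ↦ C(xᵢ)·T`). [OURS · W4.4 kill test] -/
theorem exists_weightValuation {d : ℕ} (hfd : f.IsHomogeneous d)
    (hf0 : MvPolynomial.eval (Pi.single 0 1 : Fin 3 → k) f = 0) :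
    ∃ O : ValuationSubring K, (∀ c : k, algebraMap k K c ∈ O) ∧
      O.valuation (algebraMap _ K (Ideal.Quotient.mk (Ideal.span ({f} : Set (MvPolynomial (Fin 3) k))) (X 0))) < 1 ∧
      ∀ (e : ℕ) (F : MvPolynomial (Fin 3) k), F.IsHomogeneous e →
        MvPolynomial.aeval (![algebraMap _ K (Ideal.Quotient.mk (Ideal.span ({f} : Set (MvPolynomial (Fin 3) k))) (X 0)),
          algebraMap _ K (Ideal.Quotient.mk (Ideal.span ({f} : Set (MvPolynomial (Fin 3) k))) (X 1)),
          algebraMap _ K (Ideal.Quotient.mk (Ideal.span ({f} : Set (MvPolynomial (Fin 3) k))) (X 2))] : Fin 3 → K) F ≠ 0 →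
        O.valuation (MvPolynomial.aeval (![algebraMap _ K (Ideal.Quotient.mk (Ideal.span ({f} : Set (MvPolynomial (Fin 3) k))) (X 0)),
          algebraMap _ K (Ideal.Quotient.mk (Ideal.span ({f} : Set (MvPolynomial (Fin 3) k))) (X 1)),
          algebraMap _ K (Ideal.Quotient.mk (Ideal.span ({f} : Set (MvPolynomial (Fin 3) k))) (X 2))] : Fin 3 → K) F) =
          O.valuation (algebraMap _ K (Ideal.Quotient.mk (Ideal.span ({f} : Set (MvPolynomial (Fin 3) k))) (X 0))) ^ e := by
  set A := MvPolynomial (Fin 3) k ⧸ Ideal.span ({f} : Set (MvPolynomial (Fin 3) k)) with hA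
  let ιA : A →ₐ[k] K := IsScalarTower.toAlgHom k A K
  have hι : Function.Injective ιA := IsFractionRing.injective A K
  set g : Fin 3 → K := ![algebraMap A K (Ideal.Quotient.mk _ (X 0)), algebraMap A K (Ideal.Quotient.mk _ (X 1)),
    algebraMap A K (Ideal.Quotient.mk _ (X 2))] with hg
  have hgι : g = ![ιA (Ideal.Quotient.mk _ (X 0)), ιA (Ideal.Quotient.mk _ (X 1)), ιA (Ideal.Quotient.mk _ (X 2))] := rfl
  have hker : RingHom.ker (MvPolynomial.aeval (R := k) g).toRingHom = Ideal.span {f} := by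
    rw [hgι]; exact ker_aeval_eq_span ιA hι
  have haeval : ∀ F : MvPolynomial (Fin 3) k, MvPolynomial.aeval g F = algebraMap A K (Ideal.Quotient.mk _ F) := by
    intro F
    rw [hgι, aeval_eq_comp_mk ιA]
    rfl
  let θ : MvPolynomial (Fin 3) k →ₐ[k] Polynomial K :=
    MvPolynomial.aeval (fun i => Polynomial.C (g i) * Polynomial.X)
  have hθf : ∀ b ∈ Ideal.span ({f} : Set (MvPolynomial (Fin 3) k)), θ.toRingHom b = 0 := by
    intro b hb
    obtain ⟨q, rfl⟩ := Ideal.mem_span_singleton'.mp hb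
    rw [AlgHom.toRingHom_eq_coe, RingHom.coe_coe, map_mul]
    have h0 : θ f = 0 := aeval_C_mul_X_self ιA hι hfd
    rw [h0, mul_zero]
  let θbar : A →+* Polynomial K := Ideal.Quotient.lift _ θ.toRingHom hθf
  have hθbar : ∀ F : MvPolynomial (Fin 3) k, θbar (Ideal.Quotient.mk _ F) = θ F := fun F =>
    Ideal.Quotient.lift_mk _ _ _
  have hθbar_inj : Function.Injective θbar := by
    rw [injective_iff_map_eq_zero]
    intro b hb
    obtain ⟨F, rfl⟩ := Ideal.Quotient.mk_surjective b
    rw [hθbar] at hb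
    exact Ideal.Quotient.eq_zero_iff_mem.mpr (mem_span_of_aeval_C_mul_X_eq_zero ιA hι (hgι ▸ hb))
  let θ' : A →+* RatFunc K := (algebraMap (Polynomial K) (RatFunc K)).comp θbar
  have hθ'_inj : Function.Injective θ' := (IsFractionRing.injective (Polynomial K) (RatFunc K)).comp hθbar_inj
  let φ : K →+* RatFunc K := IsFractionRing.lift hθ'_inj
  have hφ : ∀ F : MvPolynomial (Fin 3) k,
      φ (MvPolynomial.aeval g F) = algebraMap (Polynomial K) (RatFunc K) (θ F) := by
    intro F
    rw [haeval, IsFractionRing.lift_algebraMap hθ'_inj, RingHom.comp_apply, hθbar]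
  let w : Valuation K (WithZero (Multiplicative ℤ)) := ((Polynomial.idealX K).valuation (RatFunc K)).comap φ
  have hw : ∀ F : MvPolynomial (Fin 3) k, w (MvPolynomial.aeval g F) = (Polynomial.idealX K).intValuation (θ F) := by
    intro F
    rw [Valuation.comap_apply, hφ, IsDedekindDomain.HeightOneSpectrum.valuation_of_algebraMap]
  have hC : ∀ c : K, c ≠ 0 → (Polynomial.idealX K).intValuation (Polynomial.C c) = 1 := by
    intro c hc
    rw [IsDedekindDomain.HeightOneSpectrum.intValuation_eq_one_iff_mem_primeCompl, Ideal.mem_primeCompl_iff,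
      Polynomial.idealX_span, Ideal.mem_span_singleton, Polynomial.X_dvd_iff, Polynomial.coeff_C_zero]
    exact hc
  have hT : (Polynomial.idealX K).intValuation Polynomial.X < 1 := by
    rw [IsDedekindDomain.HeightOneSpectrum.intValuation_lt_one_iff_mem, Polynomial.idealX_span]
    exact Ideal.mem_span_singleton_self _
  have hform : ∀ (e : ℕ) (F : MvPolynomial (Fin 3) k), F.IsHomogeneous e → MvPolynomial.aeval g F ≠ 0 →
      w (MvPolynomial.aeval g F) = (Polynomial.idealX K).intValuation Polynomial.X ^ e := by
    intro e F hF hF0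
    rw [hw, show θ F = Polynomial.C (MvPolynomial.aeval g F) * Polynomial.X ^ e from
      CubicCone.aeval_C_mul_X_of_isHomogeneous g hF, map_mul, map_pow, hC _ hF0, one_mul]
  have hx0 : g 0 ≠ 0 := by
    have h := CubicTriangle.aeval_ne_zero_of_eval' hker (Pi.single 0 1) hf0 (F := X 0) (by simp)
    rwa [MvPolynomial.aeval_X] at h
  have hwx : w (g 0) = (Polynomial.idealX K).intValuation Polynomial.X := by
    have h := hform 1 (X 0) (isHomogeneous_X k 0) (by rw [MvPolynomial.aeval_X]; exact hx0)
    rwa [MvPolynomial.aeval_X, pow_one] at h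
  have hequiv := Valuation.isEquiv_valuation_valuationSubring w
  refine ⟨w.valuationSubring, fun c => ?_, ?_, fun e F hF hF0 => ?_⟩
  · rw [Valuation.mem_valuationSubring_iff, show algebraMap k K c = MvPolynomial.aeval g (C c) from
      (MvPolynomial.aeval_C _ _).symm, hw]
    exact IsDedekindDomain.HeightOneSpectrum.intValuation_le_one _ _
  · change w.valuationSubring.valuation (g 0) < 1
    rw [← hequiv.lt_one_iff_lt_one, hwx]
    exact hT
  · change w.valuationSubring.valuation (MvPolynomial.aeval g F) = w.valuationSubring.valuation (g 0) ^ e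
    rw [← map_pow, ← hequiv.eq_iff, hform e F hF hF0, map_pow, hwx]

/-- **`K = Frac A` is the fraction field of the range `k[x,y,z] ⊆ K`.** [folklore] -/
theorem isFractionRing_range :
    IsFractionRing ↥(MvPolynomial.aeval (R := k)
      (![algebraMap _ K (Ideal.Quotient.mk (Ideal.span ({f} : Set (MvPolynomial (Fin 3) k))) (X 0)),
        algebraMap _ K (Ideal.Quotient.mk (Ideal.span ({f} : Set (MvPolynomial (Fin 3) k))) (X 1)),
        algebraMap _ K (Ideal.Quotient.mk (Ideal.span ({f} : Set (MvPolynomial (Fin 3) k))) (X 2))] : Fin 3 → K)).range K := by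
  set A := MvPolynomial (Fin 3) k ⧸ Ideal.span ({f} : Set (MvPolynomial (Fin 3) k)) with hA
  let ιA : A →ₐ[k] K := IsScalarTower.toAlgHom k A K
  have hgι : (![algebraMap A K (Ideal.Quotient.mk _ (X 0)), algebraMap A K (Ideal.Quotient.mk _ (X 1)),
      algebraMap A K (Ideal.Quotient.mk _ (X 2))] : Fin 3 → K) =
      ![ιA (Ideal.Quotient.mk _ (X 0)), ιA (Ideal.Quotient.mk _ (X 1)), ιA (Ideal.Quotient.mk _ (X 2))] := rfl
  have hmem : ∀ b : A, algebraMap A K b ∈ (MvPolynomial.aeval (R := k) (![algebraMap A K (Ideal.Quotient.mk _ (X 0)),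
      algebraMap A K (Ideal.Quotient.mk _ (X 1)), algebraMap A K (Ideal.Quotient.mk _ (X 2))] : Fin 3 → K)).range := by
    intro b
    obtain ⟨F, rfl⟩ := Ideal.Quotient.mk_surjective b
    refine ⟨F, ?_⟩
    rw [hgι, aeval_eq_comp_mk ιA]
    rfl
  apply IsFractionRing.of_field
  intro q
  obtain ⟨b₁, b₂, -, rfl⟩ := IsFractionRing.div_surjective (A := A) q
  exact ⟨⟨algebraMap A K b₁, hmem b₁⟩, ⟨algebraMap A K b₂, hmem b₂⟩, rfl⟩

/-- **`dim k[x,y,z] = 2`** when `f` is prime (the range is isomorphic to `k[X] ⧸ (f)`, a hypersurface in affine `3`-space).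
[cite: Matsumura1987, Thm 5.6] -/
theorem ringKrullDim_range_eq_two (hprime : Prime f) :
    ringKrullDim ↥(MvPolynomial.aeval (R := k)
      (![algebraMap _ K (Ideal.Quotient.mk (Ideal.span ({f} : Set (MvPolynomial (Fin 3) k))) (X 0)),
        algebraMap _ K (Ideal.Quotient.mk (Ideal.span ({f} : Set (MvPolynomial (Fin 3) k))) (X 1)),
        algebraMap _ K (Ideal.Quotient.mk (Ideal.span ({f} : Set (MvPolynomial (Fin 3) k))) (X 2))] : Fin 3 → K)).range = 2 := by
  set A := MvPolynomial (Fin 3) k ⧸ Ideal.span ({f} : Set (MvPolynomial (Fin 3) k)) with hA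
  let ιA : A →ₐ[k] K := IsScalarTower.toAlgHom k A K
  have hι : Function.Injective ιA := IsFractionRing.injective A K
  have hgι : (![algebraMap A K (Ideal.Quotient.mk _ (X 0)), algebraMap A K (Ideal.Quotient.mk _ (X 1)),
      algebraMap A K (Ideal.Quotient.mk _ (X 2))] : Fin 3 → K) =
      ![ιA (Ideal.Quotient.mk _ (X 0)), ιA (Ideal.Quotient.mk _ (X 1)), ιA (Ideal.Quotient.mk _ (X 2))] := rfl
  have hrange : (MvPolynomial.aeval (R := k) (![algebraMap A K (Ideal.Quotient.mk _ (X 0)),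
      algebraMap A K (Ideal.Quotient.mk _ (X 1)), algebraMap A K (Ideal.Quotient.mk _ (X 2))] : Fin 3 → K)).range =
      ιA.range := by
    rw [hgι, aeval_eq_comp_mk ιA, AlgHom.range_comp, (AlgHom.range_eq_top _).mpr (Ideal.Quotient.mkₐ_surjective k _),
      Algebra.map_top]
  have e : A ≃+* ↥(MvPolynomial.aeval (R := k) (![algebraMap A K (Ideal.Quotient.mk _ (X 0)),
      algebraMap A K (Ideal.Quotient.mk _ (X 1)), algebraMap A K (Ideal.Quotient.mk _ (X 2))] : Fin 3 → K)).range :=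
    ((AlgEquiv.ofInjective ιA hι).trans (Subalgebra.equivOfEq _ _ hrange.symm)).toRingEquiv
  rw [← ringKrullDim_eq_of_ringEquiv e]
  have h := Literature.RingTheory.KrullDimension.ringKrullDim_quotient_span_of_prime_mvPolynomial hprime
  exact h.trans (by norm_num)

end Valuation

/-! ## §3 The packaged witnesses -/

/-- **NON-VACUITY FOR A GENERAL PRIME FORM (OURS · W4.4 (R-QH)).** For every field `k` and every PRIME form `f` of degree `d` in
`k[X₀,X₁,X₂]` with `f(1,0,0) = 0`: a field `K ⊇ k`, `x, y, z ∈ K` and a valuation ring `O ⊆ K` with `hker` (kernel `(f)`),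
`k ⊆ O`, `O.valuation x < 1`, the WEIGHT property, `IsFractionRing ↥k[x,y,z] K`, `ringKrullDim ↥k[x,y,z] = 2`. [OURS · W4.4 kill test] -/
theorem exists_witness_of_prime (k : Type) [Field k] {f : MvPolynomial (Fin 3) k} {d : ℕ} (hfd : f.IsHomogeneous d)
    (hprime : Prime f) (hf0 : MvPolynomial.eval (Pi.single 0 1 : Fin 3 → k) f = 0) :
    ∃ (K : Type) (_ : Field K) (_ : Algebra k K) (x y z : K) (O : ValuationSubring K),
      RingHom.ker (MvPolynomial.aeval (R := k) (![x, y, z] : Fin 3 → K)).toRingHom = Ideal.span {f} ∧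
        (∀ c : k, algebraMap k K c ∈ O) ∧ O.valuation x < 1 ∧
        (∀ (e : ℕ) (F : MvPolynomial (Fin 3) k), F.IsHomogeneous e → MvPolynomial.aeval ![x, y, z] F ≠ 0 →
          O.valuation (MvPolynomial.aeval ![x, y, z] F) = O.valuation x ^ e) ∧
        IsFractionRing ↥(MvPolynomial.aeval (R := k) (![x, y, z] : Fin 3 → K)).range K ∧
        ringKrullDim ↥(MvPolynomial.aeval (R := k) (![x, y, z] : Fin 3 → K)).range = 2 := by
  haveI : (Ideal.span ({f} : Set (MvPolynomial (Fin 3) k))).IsPrime := (Ideal.span_singleton_prime hprime.ne_zero).mpr hprime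
  letI : IsDomain (MvPolynomial (Fin 3) k ⧸ Ideal.span ({f} : Set (MvPolynomial (Fin 3) k))) := Ideal.Quotient.isDomain _
  set A := MvPolynomial (Fin 3) k ⧸ Ideal.span ({f} : Set (MvPolynomial (Fin 3) k)) with hA
  obtain ⟨O, hk, hx, hW⟩ := exists_weightValuation (k := k) (K := FractionRing A) hfd hf0
  refine ⟨FractionRing A, inferInstance, inferInstance,
    algebraMap A (FractionRing A) (Ideal.Quotient.mk (Ideal.span ({f} : Set (MvPolynomial (Fin 3) k))) (X 0)),
    algebraMap A (FractionRing A) (Ideal.Quotient.mk (Ideal.span ({f} : Set (MvPolynomial (Fin 3) k))) (X 1)),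
    algebraMap A (FractionRing A) (Ideal.Quotient.mk (Ideal.span ({f} : Set (MvPolynomial (Fin 3) k))) (X 2)), O, ?_, hk, hx, hW,
    isFractionRing_range, ringKrullDim_range_eq_two hprime⟩
  exact ker_aeval_eq_span (IsScalarTower.toAlgHom k A (FractionRing A)) (IsFractionRing.injective A _)

/-- The member `a = (1,0,1,0,1,0,0)` of the family is `x²y + y²z + z²x`, PRIME over every field (`CubicCone.prime_f`, p546768). [folklore] -/
theorem prime_cubicTriangle_std (k : Type) [Field k] :
    Prime (C ((![1, 0, 1, 0, 1, 0, 0] : Fin 7 → k) 0) * (X 0 ^ 2 * X 1) + C ((![1, 0, 1, 0, 1, 0, 0] : Fin 7 → k) 1) * (X 0 ^ 2 * X 2) +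
      C ((![1, 0, 1, 0, 1, 0, 0] : Fin 7 → k) 2) * (X 1 ^ 2 * X 2) + C ((![1, 0, 1, 0, 1, 0, 0] : Fin 7 → k) 3) * (X 1 ^ 2 * X 0) +
      C ((![1, 0, 1, 0, 1, 0, 0] : Fin 7 → k) 4) * (X 2 ^ 2 * X 0) + C ((![1, 0, 1, 0, 1, 0, 0] : Fin 7 → k) 5) * (X 2 ^ 2 * X 1) +
      C ((![1, 0, 1, 0, 1, 0, 0] : Fin 7 → k) 6) * (X 0 * X 1 * X 2) : MvPolynomial (Fin 3) k) := by
  have h := CubicCone.prime_f k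
  convert h using 1
  simp

/-- **THE EXIT IS INHABITED FOR EVERY PRIME MEMBER OF THE FAMILY (OURS · W4.4 (R-QH)).** For every prime `p`, field `k` of
characteristic `p` and `a : Fin 7 → k` with `a₀ ≠ 0`, `a₂ ≠ 0` and `f_a` prime: there is a kill-test datum — `A = k[x,y,z]`
cut out by `f_a` inside its fraction field `K`, `O` its weight valuation ring, `k ⊆ O`, `A.FG`, `Frac A = K`, `A ⊆ O`,
`dim A = 2` — AT WHICH **`∃ m, IsRegularLocalRing ↥(tower O A m)`** is kernel-certified. [OURS · W4.4 kill test] -/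
theorem exists_isRegularLocalRing_tower_cubicTriangle_inhabited (p : ℕ) (hp : p.Prime) (k : Type) [Field k] [CharP k p]
    (a : Fin 7 → k) (h0 : a 0 ≠ 0) (h2 : a 2 ≠ 0) (hprime : Prime (C (a 0) * (X 0 ^ 2 * X 1) + C (a 1) * (X 0 ^ 2 * X 2) + C (a 2) * (X 1 ^ 2 * X 2) + C (a 3) * (X 1 ^ 2 * X 0) +
        C (a 4) * (X 2 ^ 2 * X 0) + C (a 5) * (X 2 ^ 2 * X 1) + C (a 6) * (X 0 * X 1 * X 2) : MvPolynomial (Fin 3) k)) :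
    ∃ (K : Type) (_ : Field K) (_ : Algebra k K) (x y z : K) (O : ValuationSubring K),
      RingHom.ker (MvPolynomial.aeval (R := k) (![x, y, z] : Fin 3 → K)).toRingHom = Ideal.span {C (a 0) * (X 0 ^ 2 * X 1) + C (a 1) * (X 0 ^ 2 * X 2) + C (a 2) * (X 1 ^ 2 * X 2) + C (a 3) * (X 1 ^ 2 * X 0) +
        C (a 4) * (X 2 ^ 2 * X 0) + C (a 5) * (X 2 ^ 2 * X 1) + C (a 6) * (X 0 * X 1 * X 2)} ∧
        (∀ c : k, algebraMap k K c ∈ O) ∧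
        (MvPolynomial.aeval (R := k) (![x, y, z] : Fin 3 → K)).range.FG ∧
        IsFractionRing ↥(MvPolynomial.aeval (R := k) (![x, y, z] : Fin 3 → K)).range K ∧
        (MvPolynomial.aeval (R := k) (![x, y, z] : Fin 3 → K)).range.toSubring ≤ O.toSubring ∧
        ringKrullDim ↥(MvPolynomial.aeval (R := k) (![x, y, z] : Fin 3 → K)).range = 2 ∧
        ∃ m : ℕ, IsRegularLocalRing ↥(tower O (MvPolynomial.aeval (R := k) (![x, y, z] : Fin 3 → K)).range m) := by
  obtain ⟨K, _, _, x, y, z, O, hker, hk, hx, hW, hfr, hdim⟩ :=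
    exists_witness_of_prime k (isHomogeneous_cubicTriangle a) hprime (eval_single_cubicTriangle a 0)
  have hA : (MvPolynomial.aeval (R := k) (![x, y, z] : Fin 3 → K)).range.FG :=
    ⟨(Set.finite_range ![x, y, z]).toFinset, by rw [Set.Finite.coe_toFinset, Algebra.adjoin_range_eq_range_aeval]⟩
  have hAO : (MvPolynomial.aeval (R := k) (![x, y, z] : Fin 3 → K)).range.toSubring ≤ O.toSubring := by
    rintro b ⟨q, rfl⟩
    exact HomologicalConductor.KC3Upper.aeval_mem_valuationSubring _ O hk
      (valuation_coord_lt_one' hker (eval_single_cubicTriangle a) hW hx) q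
  exact ⟨K, inferInstance, inferInstance, x, y, z, O, hker, hk, hA, hfr, hAO, hdim,
    exists_isRegularLocalRing_tower_cubicTriangle hker hW hx hk h0 h2 p hp hfr hdim⟩

end Summit.ResolutionOfSingularities.ResolutionOfSingularities.Theorems.SurfaceTermination.CubicTriangle

end
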